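/-
Copyright: cell pub-balaban-gaps (YM BLITZ Y1, track G1), seat g1-p2 GEN 10 (unit `pub-balaban-gaps-g1-p2`).  Row (D4) NODE O,
OBJECT ∕ MECHANISM level, CARRIER-GENERIC: the COVARIANT-DIFFERENCE CURRENCY.  Print's Thm 3.1 (3.42) and (3.61) are stated with the
covariant derivative `∇_U` («(L^jη)^{−1}|∇_Uλ|»); the Cor. 3.5 ENDs of this chain carry the level-weighted FLAT family `{w², w∂_μ, w∂⁻_μ}`
(`covDopW`), which does not pass a site gauge.  Here: `∇_{U,μ} = η⁻¹(U_μ·S_μ − 1)`, `∇⁻_{U,μ} = η⁻¹(1 − U_μ(· − e_μ)⁻¹·S⁻_μ)` as fibred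
operators, `Δ_W(U) = η⁻¹Σ_μ(∇⁻ − ∇)`, GAUGE COVARIANCE `∇_{U^g} = fibD g·∇_U·fibD g⁻` (so the weighted covariant family passes the gauge:
`w∇_U(fibD g⁻·T·fibD g) = fibD g⁻·(w∇_{U^g}T)·fibD g`), and the LETTER COMPARISON in the (3.37) window, block by block and distance-free:
`‖w∇_UT‖_{Y,Y′} ≤ (1 + α)‖w∂T‖_{Y,Y′} + α‖w²T‖_{Y,Y′}`, `‖w∇⁻_UT‖_{Y,Y′} ≤ (1 + α)‖w∂⁻T‖_{Y,Y′} + Λα‖w²T‖_{Y,Y′}`.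
HONEST FRAMING: elementary algebra + one row-sum estimate; `U`, `g` hypothesis SHAPES; nothing of Bałaban's constructed; (D4) NOT
discharged (instance 0∕1); NOT BetaPertH, NOT continuum, NOT Clay.
-/
import Summits.QuantumFields.BalabanUV.Gaps.D4WalkBlockGaugeAlgebra
import Summits.QuantumFields.BalabanUV.Gaps.D4WalkBlockConjugate

/-!
# `Gaps.D4WalkBlockCovariantDerivative` — covariant differences as fibred operators: `Δ_W = η⁻¹Σ(∇⁻ − ∇)`, gauge covariance, and the
# weighted covariant letters from the weighted flat letters in the (3.37) window (carrier-generic; cell pub-balaban-gaps, g1-p2 gen 10)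

HONEST DEPENDENCY (cell pub-balaban, verbatim): continuum YM on T⁴ ⇐ BetaPertH ∧ nine spine estimates (0/9 proved);
BetaPertH ⇐ (D1) ∧ (D4) ∧ CAP+tail.

Data: carrier `X`, fibre `F`, shifts `sh μ`, scale `η`, transporters `U_μ(u,x)` (forward) and `U⁻_μ(u,y) = U_μ(u,y)⁻¹` (read at
`y = x − e_μ`), exactly as the Cor. 3.5 ENDs (`D4WalkBlockCovariantGreenMultiLevel`) take them.
* §1 `covDf`, `covDb`, `fibD_sub_one`, **`covDf_eq_flat`** ∕ **`covDb_eq_flat`** (`∇_U = ∂ + η⁻¹(U − 1)S`, `∇⁻_U = ∂⁻ − η⁻¹(U⁻(· − e) − 1)S⁻`),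
  **`covLap_eq_covD`** (72's `covLap` at the defects `U − 1`, `U⁻(· − e) − 1` IS `η⁻¹Σ_μ(∇⁻_{U,μ} − ∇_{U,μ})`).
* §2 **`covDf_gauge`**, **`covDb_gauge`** (`U^g_μ(x) = g(x)U_μ(x)g⁻(x + e_μ)`, `(U^g)⁻_μ(y) = g(y + e_μ)U⁻_μ(y)g⁻(y)`), `covDf_mul_conj` ∕
  `covDb_mul_conj` (TRANSFER identity `∇_U·(fibD g⁻·M·fibD g) = fibD g⁻·(∇_{U^g}·M)·fibD g`).
* §3 **`covDopU`** `= {w², w∇_{U,μ}, w∇⁻_{U,μ}}` (index type of `covDopW`), `wOp_mul_wOp`, **`covDopU_mul_conj`** (the family passes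
  the gauge), **`blockNorm_wcovDf_le`** ∕ **`blockNorm_wcovDb_le`**
  (`η > 0`, `w > 0`, `ηw ≤ 1`, windows `Σ_b‖(U_μ(u,x) − 1)_{ab}‖ ≤ ηα·w(x)`, `Σ_b‖(U⁻_μ(u,y) − 1)_{ab}‖ ≤ ηα·w(y)`, backward ratio
  `w(x − e_μ) ≤ Λw(x)` ⟹ the two displayed inequalities, for ANY kernel and pair of cubes — hence for every term of a block walk expansion
  with its own walks, distances and rates).
WHAT IT IS NOT.  An END (consumer: the gauge transfer `D4WalkBlockCovariantGaugeMultiLevel`, staged); Bałaban's `U′`; (D4) instance 0∕1.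

References: T. Bałaban, Comm. Math. Phys. **99** (1985) 389–434 [B9], (3.6) p. 391, (3.23) p. 394, (3.37) p. 396, Thm 3.1 (3.42)
p. 397, p. 398 («invariant with respect to gauge transformations of U»), (3.50) p. 400, (3.61) p. 402, Cor. 3.6 p. 408.
-/

noncomputable section

namespace Summit.QuantumFields.BalabanUV.Gaps.D4WalkBlockCovariantDerivative

open Metric Set Finset
open scoped Matrix
open Literature.MathematicalPhysics.QuantumFieldTheory.Balaban1983to89
open Literature.MathematicalPhysics.QuantumFieldTheory.Balaban1983to89.B9Thm37GlueTorus (tdist1 tdist1_nonneg)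
open Literature.MathematicalPhysics.QuantumFieldTheory.Balaban1983to89.B5TorusCover (UT)
open Summit.QuantumFields.BalabanUV.Gaps.D4WalkBlock (blockNorm blockNorm_nonneg blockNorm_add_le blockNorm_smul_le)
open Summit.QuantumFields.BalabanUV.Gaps.D4WalkBlockConjugate (blockNorm_local_mul_le)
open Summit.QuantumFields.BalabanUV.Gaps.D4WalkBlockShiftAlgebra
  (fibD relab Sfw Sbw Dfw fibD_local fibD_smul relab_mul_relab relab_id blockNorm_relab_mul_le)
open Summit.QuantumFields.BalabanUV.Gaps.D4WalkBlockShiftStep (covLap Sbw_mul_Sfw Sfw_eq Sbw_eq)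
open Summit.QuantumFields.BalabanUV.Gaps.D4WalkBlockShiftWeighted
  (fibD_mul wOp wOp_mul_fibD fibD_mul_wOp covDopW blockNorm_wOp_relab_mul_le)
open Summit.QuantumFields.BalabanUV.Gaps.D4WalkBlockGaugeAlgebra
  (fibD_const_one one_add_fibD_sub_one fibD_mul_fibD_eq_one relab_mul_fibD gauge_shift_term rowSum_fibD)

variable {X : Type} {F : Type} [Fintype X] [Fintype F] [DecidableEq X] [DecidableEq F] {ι : Type} [Fintype ι]
variable (sh : ι → X ≃ X) (η : ℝ) {E : Type*}
variable (U Ui : ι → E → X → Matrix F F ℂ)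

/-! ## §1. Covariant differences as fibred operators; `Δ_W = η⁻¹Σ(∇⁻ − ∇)` -/

section Defs

/-- **The covariant forward difference** `∇_{U,μ} ⊗`: `(∇_{U,μ}λ)(x) = η⁻¹(U_μ(u,x)λ(x + e_μ) − λ(x))`, as the fibred operator
`η⁻¹(fibD U_μ(u)·S_μ − 1)`. [cite: Balaban1985BackgroundPropagators, (3.6) p.391, (3.23) p.394] -/
def covDf (μ : ι) (u : E) : Matrix (X × F) (X × F) ℂ := ((η : ℂ)⁻¹) • (fibD X F (U μ u) * Sfw X F sh μ - 1)

/-- **The covariant backward difference** `∇⁻_{U,μ} ⊗`: `(∇⁻_{U,μ}λ)(x) = η⁻¹(λ(x) − U_μ(u,x − e_μ)⁻¹λ(x − e_μ))`, as the fibred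
operator `η⁻¹(1 − fibD (U⁻_μ(u, · − e_μ))·S⁻_μ)` (`U⁻_μ(u,y) = U_μ(u,y)⁻¹` read at `y = x − e_μ`). [cite: Balaban1985BackgroundPropagators, (3.6) p.391, (3.50) p.400] -/
def covDb (μ : ι) (u : E) : Matrix (X × F) (X × F) ℂ :=
  ((η : ℂ)⁻¹) • (1 - fibD X F (fun x => Ui μ u ((sh μ).symm x)) * Sbw X F sh μ)

variable {sh η U Ui}

omit [Fintype X] [Fintype F] in
/-- `fibD (V − 1) = fibD V − 1` (the transport defect). -/
theorem fibD_sub_one (V : X → Matrix F F ℂ) : fibD X F (fun x => V x - 1) = fibD X F V - 1 := by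
  rw [← one_add_fibD_sub_one V]; abel

omit [Fintype ι] in
/-- **`∇_U = ∂ + η⁻¹(U − 1)·S`**: the covariant forward difference is the flat one plus the forward transport defect term. -/
theorem covDf_eq_flat (μ : ι) (u : E) :
    covDf sh η U μ u = Dfw X F sh η μ + ((η : ℂ)⁻¹) • (fibD X F (fun x => U μ u x - 1) * Sfw X F sh μ) := by
  unfold covDf Dfw
  rw [fibD_sub_one, ← smul_add]
  congr 1
  rw [Matrix.sub_mul, Matrix.one_mul]
  abel

omit [Fintype ι] in
/-- **`∇⁻_U = ∂⁻ − η⁻¹(U⁻(· − e) − 1)·S⁻`** with `∂⁻ = S⁻_μ∂_μ = η⁻¹(1 − S⁻_μ)` (the third member of the flat family). -/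
theorem covDb_eq_flat (μ : ι) (u : E) :
    covDb sh η Ui μ u = Sbw X F sh μ * Dfw X F sh η μ -
      ((η : ℂ)⁻¹) • (fibD X F (fun x => Ui μ u ((sh μ).symm x) - 1) * Sbw X F sh μ) := by
  unfold covDb Dfw
  rw [fibD_sub_one (fun x => Ui μ u ((sh μ).symm x)), Matrix.mul_smul, Matrix.mul_sub, Matrix.mul_one, Sbw_mul_Sfw, ← smul_sub]
  congr 1
  rw [Matrix.sub_mul, Matrix.one_mul]
  abel

/-- **`Δ_W(U) = η⁻¹Σ_μ(∇⁻_{U,μ} − ∇_{U,μ})`**: 72's covariant Laplacian with the transport defects `W⁺_μ = U_μ − 1`,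
`W⁻_μ = U⁻_μ(· − e_μ) − 1` IS the divergence of the covariant differences. [cite: Balaban1985BackgroundPropagators, (3.23) p.394, (3.50) p.400] -/
theorem covLap_eq_covD (u : E) :
    covLap X F sh η (fun ν u x => U ν u x - 1) (fun ν u x => Ui ν u ((sh ν).symm x) - 1) u =
      ((η : ℂ)⁻¹) • ∑ μ, (covDb sh η Ui μ u - covDf sh η U μ u) := by
  unfold covLap covDb covDf
  simp only [one_add_fibD_sub_one]
  rw [pow_two, ← smul_smul, Finset.smul_sum]
  congr 1
  refine Finset.sum_congr rfl fun μ _ => ?_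
  rw [← smul_sub]
  congr 1
  rw [two_smul]
  abel

end Defs

/-! ## §2. Gauge covariance of the covariant differences; the transfer identity -/

section Gauge

variable {sh η U Ui} {g gi : X → Matrix F F ℂ}

omit [Fintype ι] in
/-- **`∇_{U^g,μ} = fibD g·∇_{U,μ}·fibD g⁻`** with `U^g_μ(x) = g(x)U_μ(x)g⁻(x + e_μ)`. [cite: Balaban1985BackgroundPropagators, p.398] -/
theorem covDf_gauge (hg : ∀ x, g x * gi x = 1) (μ : ι) (u : E) :
    covDf sh η (fun ν u x => g x * U ν u x * gi (sh ν x)) μ u = fibD X F g * covDf sh η U μ u * fibD X F gi := by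
  unfold covDf
  rw [Matrix.mul_smul, Matrix.smul_mul, Matrix.mul_sub, Matrix.sub_mul, Matrix.mul_one, fibD_mul_fibD_eq_one hg]
  unfold Sfw
  rw [gauge_shift_term]

omit [Fintype ι] in
/-- **`∇⁻_{U^g,μ} = fibD g·∇⁻_{U,μ}·fibD g⁻`** with `(U^g)⁻_μ(y) = g(y + e_μ)U⁻_μ(y)g⁻(y)` (read at `y = x − e_μ`, `g(sh(sh⁻¹x))` unreduced,
as the ENDs instantiate it). [cite: Balaban1985BackgroundPropagators, p.398] -/
theorem covDb_gauge (hg : ∀ x, g x * gi x = 1) (μ : ι) (u : E) :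
    covDb sh η (fun ν u y => g (sh ν y) * Ui ν u y * gi y) μ u = fibD X F g * covDb sh η Ui μ u * fibD X F gi := by
  unfold covDb
  have e : (fun x => g (sh μ ((sh μ).symm x)) * Ui μ u ((sh μ).symm x) * gi ((sh μ).symm x)) =
      fun x => g x * Ui μ u ((sh μ).symm x) * gi ((sh μ).symm x) := by
    funext x; rw [Equiv.apply_symm_apply]
  rw [e, Matrix.mul_smul, Matrix.smul_mul, Matrix.mul_sub, Matrix.sub_mul, Matrix.mul_one, fibD_mul_fibD_eq_one hg]
  unfold Sbw
  rw [gauge_shift_term]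

omit [Fintype ι] in
/-- **THE TRANSFER IDENTITY (forward)**: `∇_{U,μ}·(fibD g⁻·M·fibD g) = fibD g⁻·(∇_{U^g,μ}·M)·fibD g` — a covariant-difference letter of
a kernel conjugated back from the gauge `U^g` IS the conjugate of the covariant letter at `U^g`. -/
theorem covDf_mul_conj (hg : ∀ x, g x * gi x = 1) (hgi : ∀ x, gi x * g x = 1) (μ : ι) (u : E)
    (M : Matrix (X × F) (X × F) ℂ) :
    covDf sh η U μ u * (fibD X F gi * M * fibD X F g) =
      fibD X F gi * (covDf sh η (fun ν u x => g x * U ν u x * gi (sh ν x)) μ u * M) * fibD X F g := by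
  rw [covDf_gauge hg]
  simp only [← Matrix.mul_assoc]
  rw [fibD_mul_fibD_eq_one hgi, Matrix.one_mul]

omit [Fintype ι] in
/-- **THE TRANSFER IDENTITY (backward)**: `∇⁻_{U,μ}·(fibD g⁻·M·fibD g) = fibD g⁻·(∇⁻_{U^g,μ}·M)·fibD g`. -/
theorem covDb_mul_conj (hg : ∀ x, g x * gi x = 1) (hgi : ∀ x, gi x * g x = 1) (μ : ι) (u : E)
    (M : Matrix (X × F) (X × F) ℂ) :
    covDb sh η Ui μ u * (fibD X F gi * M * fibD X F g) =
      fibD X F gi * (covDb sh η (fun ν u y => g (sh ν y) * Ui ν u y * gi y) μ u * M) * fibD X F g := by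
  rw [covDb_gauge hg]
  simp only [← Matrix.mul_assoc]
  rw [fibD_mul_fibD_eq_one hgi, Matrix.one_mul]

end Gauge

/-! ## §3. The weighted covariant family and its letters from the weighted flat letters -/

section Weighted

variable (w : X → ℝ)

/-- **The weighted COVARIANT family** `{w², w∇_{U,μ}, w∇⁻_{U,μ}}` — print's «(L^jη)^{−2}|λ|, (L^jη)^{−1}|∇_Uλ|» literally, same index
type as the flat family `covDopW`. [cite: Balaban1985BackgroundPropagators, Thm 3.1 (3.42) p.397, (3.61) p.402] -/
def covDopU (u : E) : Unit ⊕ (ι ⊕ ι) → Matrix (X × F) (X × F) ℂ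
  | Sum.inl _ => wOp X F (fun x => w x ^ 2)
  | Sum.inr (Sum.inl μ) => wOp X F w * covDf sh η U μ u
  | Sum.inr (Sum.inr μ) => wOp X F w * covDb sh η Ui μ u

variable {sh η U Ui w}

/-- `(w ⊗ 1)(w′ ⊗ 1) = (ww′) ⊗ 1`. -/
theorem wOp_mul_wOp (w₁ w₂ : X → ℝ) : wOp X F w₁ * wOp X F w₂ = wOp X F (fun x => w₁ x * w₂ x) := by
  unfold wOp
  rw [fibD_mul]
  congr 1; funext x
  rw [Matrix.smul_mul, Matrix.one_mul, smul_smul, Complex.ofReal_mul]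

/-- the weight commutes with every site-diagonal operator. -/
theorem wOp_mul_fibD_comm (w₁ : X → ℝ) (a : X → Matrix F F ℂ) : wOp X F w₁ * fibD X F a = fibD X F a * wOp X F w₁ := by
  rw [wOp_mul_fibD, fibD_mul_wOp]

omit [Fintype ι] in
/-- **THE WHOLE WEIGHTED COVARIANT FAMILY PASSES THE GAUGE**: `D̃_j(U)·(fibD g⁻·M·fibD g) = fibD g⁻·(D̃_j(U^g)·M)·fibD g` for every
member `j` (the weight is site-diagonal and real, so it commutes with `fibD g^{∓}`). -/
theorem covDopU_mul_conj {g gi : X → Matrix F F ℂ} (hg : ∀ x, g x * gi x = 1) (hgi : ∀ x, gi x * g x = 1) (u : E)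
    (M : Matrix (X × F) (X × F) ℂ) (j : Unit ⊕ (ι ⊕ ι)) :
    covDopU sh η U Ui w u j * (fibD X F gi * M * fibD X F g) =
      fibD X F gi * (covDopU sh η (fun ν u x => g x * U ν u x * gi (sh ν x)) (fun ν u y => g (sh ν y) * Ui ν u y * gi y) w u j * M) *
        fibD X F g := by
  rcases j with v | (μ | μ)
  · dsimp only [covDopU]
    simp only [← Matrix.mul_assoc]
    rw [wOp_mul_fibD_comm]
  · dsimp only [covDopU]
    rw [Matrix.mul_assoc (wOp X F w) (covDf sh η U μ u), covDf_mul_conj hg hgi]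
    simp only [← Matrix.mul_assoc]
    rw [wOp_mul_fibD_comm]
  · dsimp only [covDopU]
    rw [Matrix.mul_assoc (wOp X F w) (covDb sh η Ui μ u), covDb_mul_conj hg hgi]
    simp only [← Matrix.mul_assoc]
    rw [wOp_mul_fibD_comm]

variable {ν : ℕ} {Kv : Fin ν → ℕ}

omit [DecidableEq F] in
/-- fibre row masses of `η⁻¹w⁻¹·V` from those of `V`: `Σ_b‖V_{ab}‖ ≤ ηα·w′` ⟹ `Σ_b‖(η⁻¹w⁻¹V)_{ab}‖ ≤ α·w′/w` (`η, w > 0`). -/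
theorem rowSum_rescaled_le (hη : 0 < η) {wx wy α : ℝ} (hwx : 0 < wx) {V : Matrix F F ℂ} (a : F)
    (hV : ∑ b, ‖V a b‖ ≤ η * α * wy) :
    ∑ b, ‖((((η : ℂ)⁻¹) * (((wx⁻¹ : ℝ)) : ℂ)) • V) a b‖ ≤ α * (wy / wx) := by
  have hn : ‖((η : ℂ)⁻¹) * (((wx⁻¹ : ℝ)) : ℂ)‖ = η⁻¹ * wx⁻¹ := by
    rw [norm_mul, norm_inv, Complex.norm_real, Complex.norm_real, Real.norm_eq_abs, Real.norm_eq_abs, abs_of_pos hη,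
      abs_of_pos (inv_pos.2 hwx)]
  calc ∑ b, ‖((((η : ℂ)⁻¹) * (((wx⁻¹ : ℝ)) : ℂ)) • V) a b‖ = (η⁻¹ * wx⁻¹) * ∑ b, ‖V a b‖ := by
        rw [Finset.mul_sum]
        exact Finset.sum_congr rfl fun b _ => by rw [Matrix.smul_apply, smul_eq_mul, norm_mul, hn]
    _ ≤ (η⁻¹ * wx⁻¹) * (η * α * wy) := mul_le_mul_of_nonneg_left hV (by positivity)
    _ = α * (wy / wx) := by field_simp

omit [Fintype ι] [DecidableEq X] [DecidableEq F] in
/-- `blockNorm (−M) = blockNorm M`. -/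
theorem blockNorm_neg (cub : X → UT Kv) (M : Matrix (X × F) (X × F) ℂ) (Y Y' : UT Kv) :
    blockNorm (fun p : X × F => cub p.1) (fun p : X × F => cub p.1) (-M) Y Y' =
      blockNorm (fun p : X × F => cub p.1) (fun p : X × F => cub p.1) M Y Y' := by
  unfold blockNorm D4WalkBlock.rowMass
  simp only [Matrix.neg_apply, norm_neg]

omit [Fintype ι] in
/-- **THE FORWARD COVARIANT LETTER FROM THE FLAT ONES — block by block, distance-free.**  `η > 0`, weight `w > 0` with `ηw ≤ 1`
(print: `w = (L^jη)^{−1} ≤ η^{−1}`), forward window `Σ_b‖(U_μ(u,x) − 1)_{ab}‖ ≤ ηα·w(x)`: for every kernel `T` and every pair of cubes,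
`‖(w ⊗ 1)∇_{U,μ}T‖_{Y,Y′} ≤ (1 + α)‖(w ⊗ 1)∂_μT‖_{Y,Y′} + α‖(w² ⊗ 1)T‖_{Y,Y′}` — because `∇_U = ∂ + η⁻¹(U − 1)(1 + η∂)` and
`η⁻¹(U − 1) = [η⁻¹w⁻¹(U − 1)]·w`, `(U − 1)` have fibre row sums `≤ α`.  So the weighted flat letters of a block walk expansion (value `w²`,
derivative `w∂`) give print's covariant letters `(L^jη)^{−1}|∇_UG|` with the SAME walks, distances and rates.
[cite: Balaban1985BackgroundPropagators, Thm 3.1 (3.42) p.397, (3.37) p.396, (3.61) p.402] -/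
theorem blockNorm_wcovDf_le (cub : X → UT Kv) (μ : ι) (hη : 0 < η) (hw : ∀ x, 0 < w x) (hηw : ∀ x, η * w x ≤ 1) {α : ℝ}
    (hα : 0 ≤ α) (u : E) (hU : ∀ x a, ∑ b, ‖(U μ u x - 1) a b‖ ≤ η * α * w x) (T : Matrix (X × F) (X × F) ℂ) (Y Y' : UT Kv) :
    blockNorm (fun p : X × F => cub p.1) (fun p : X × F => cub p.1) (wOp X F w * covDf sh η U μ u * T) Y Y' ≤
      (1 + α) * blockNorm (fun p : X × F => cub p.1) (fun p : X × F => cub p.1) (wOp X F w * Dfw X F sh η μ * T) Y Y' +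
        α * blockNorm (fun p : X × F => cub p.1) (fun p : X × F => cub p.1) (wOp X F (fun x => w x ^ 2) * T) Y Y' := by
  -- `w∇_U T = w∂T + fibD c′·(w²T) + fibD (U − 1)·(w∂T)`, `c′(x) = η⁻¹w(x)⁻¹(U_μ(u,x) − 1)`
  set c' : X → Matrix F F ℂ := fun x => (((η : ℂ)⁻¹) * ((((w x)⁻¹ : ℝ)) : ℂ)) • (U μ u x - 1) with hc'
  have hc'row : ∀ p : X × F, ∑ q, ‖fibD X F c' p q‖ ≤ α := fun p => by
    rw [rowSum_fibD]
    refine (rowSum_rescaled_le hη (hw p.1) p.2 (hU p.1 p.2)).trans (le_of_eq ?_)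
    rw [div_self (hw p.1).ne', mul_one]
  have hc2row : ∀ p : X × F, ∑ q, ‖fibD X F (fun x => U μ u x - 1) p q‖ ≤ α := fun p => by
    rw [rowSum_fibD]
    refine (hU p.1 p.2).trans ?_
    calc η * α * w p.1 = α * (η * w p.1) := by ring
      _ ≤ α * 1 := mul_le_mul_of_nonneg_left (hηw p.1) hα
      _ = α := mul_one α
  have hloc : ∀ (c : X → Matrix F F ℂ) (p q : X × F),
      (fun p : X × F => cub p.1) p ≠ (fun p : X × F => cub p.1) q → fibD X F c p q = 0 :=
    fun c p q h => by_contra fun hne => h (fibD_local cub c p q hne)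
  have e1 : ((η : ℂ)⁻¹) • fibD X F (fun x => U μ u x - 1) = fibD X F c' * wOp X F w := by
    rw [fibD_mul_wOp, ← fibD_smul]
    congr 1; funext x
    rw [hc', smul_smul]
    congr 1
    have hx : ((w x : ℝ) : ℂ) ≠ 0 := by exact_mod_cast (hw x).ne'
    push_cast
    rw [mul_left_comm, mul_inv_cancel₀ hx, mul_one]
  have hη' : (η : ℂ) ≠ 0 := by exact_mod_cast hη.ne'
  have key : ((η : ℂ)⁻¹) • (fibD X F (fun x => U μ u x - 1) * Sfw X F sh μ) =
      fibD X F c' * wOp X F w + fibD X F (fun x => U μ u x - 1) * Dfw X F sh η μ := by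
    rw [Sfw_eq hη.ne' μ, Matrix.mul_add, Matrix.mul_one, smul_add, e1, Matrix.mul_smul, smul_smul, inv_mul_cancel₀ hη',
      one_smul]
  have t1 : wOp X F w * (fibD X F c' * wOp X F w) * T = fibD X F c' * (wOp X F (fun x => w x ^ 2) * T) := by
    calc wOp X F w * (fibD X F c' * wOp X F w) * T = (wOp X F w * fibD X F c') * (wOp X F w * T) := by
          simp only [Matrix.mul_assoc]
      _ = fibD X F c' * (wOp X F (fun x => w x ^ 2) * T) := by
          rw [wOp_mul_fibD_comm, Matrix.mul_assoc, ← Matrix.mul_assoc (wOp X F w) (wOp X F w), wOp_mul_wOp]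
          simp only [pow_two]
  have t2 : wOp X F w * (fibD X F (fun x => U μ u x - 1) * Dfw X F sh η μ) * T =
      fibD X F (fun x => U μ u x - 1) * (wOp X F w * Dfw X F sh η μ * T) := by
    calc wOp X F w * (fibD X F (fun x => U μ u x - 1) * Dfw X F sh η μ) * T =
          (wOp X F w * fibD X F (fun x => U μ u x - 1)) * Dfw X F sh η μ * T := by simp only [Matrix.mul_assoc]
      _ = fibD X F (fun x => U μ u x - 1) * (wOp X F w * Dfw X F sh η μ * T) := by
          rw [wOp_mul_fibD_comm]; simp only [Matrix.mul_assoc]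
  have hsplit : wOp X F w * covDf sh η U μ u * T =
      wOp X F w * Dfw X F sh η μ * T + fibD X F c' * (wOp X F (fun x => w x ^ 2) * T) +
        fibD X F (fun x => U μ u x - 1) * (wOp X F w * Dfw X F sh η μ * T) := by
    rw [covDf_eq_flat, key, Matrix.mul_add, Matrix.mul_add, Matrix.add_mul, Matrix.add_mul, t1, t2, add_assoc]
  rw [hsplit]
  refine ((blockNorm_add_le _ _ _ _ _ _).trans (add_le_add ((blockNorm_add_le _ _ _ _ _ _).trans (add_le_add le_rfl
    (blockNorm_local_mul_le _ _ (fibD X F c') (hloc c') hα hc'row _ Y Y')))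
    (blockNorm_local_mul_le _ _ (fibD X F _) (hloc _) hα hc2row _ Y Y'))).trans (le_of_eq ?_)
  ring

omit [Fintype ι] in
/-- **THE BACKWARD COVARIANT LETTER FROM THE FLAT ONES — block by block, distance-free.**  `η > 0`, `w > 0`, `ηw ≤ 1`, BACKWARD
neighbour ratio `w(x − e_μ) ≤ Λ·w(x)` (levels of neighbours differ by `≤ 1`), backward window `Σ_b‖(U⁻_μ(u,y) − 1)_{ab}‖ ≤ ηα·w(y)`:
`‖(w ⊗ 1)∇⁻_{U,μ}T‖_{Y,Y′} ≤ (1 + α)‖(w ⊗ 1)∂⁻_μT‖_{Y,Y′} + Λα‖(w² ⊗ 1)T‖_{Y,Y′}` (`∂⁻_μ = S⁻_μ∂_μ`), because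
`∇⁻_U = ∂⁻ − η⁻¹(U⁻(· − e) − 1)(1 − η∂⁻)`. [cite: Balaban1985BackgroundPropagators, Thm 3.1 (3.42) p.397, (3.37) p.396, (3.61) p.402] -/
theorem blockNorm_wcovDb_le (cub : X → UT Kv) (μ : ι) (hη : 0 < η) (hw : ∀ x, 0 < w x) (hηw : ∀ x, η * w x ≤ 1) {Λ : ℝ}
    (hΛ : 0 ≤ Λ) (hwb : ∀ x, w ((sh μ).symm x) ≤ Λ * w x) {α : ℝ} (hα : 0 ≤ α) (u : E)
    (hUi : ∀ y a, ∑ b, ‖(Ui μ u y - 1) a b‖ ≤ η * α * w y) (T : Matrix (X × F) (X × F) ℂ) (Y Y' : UT Kv) :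
    blockNorm (fun p : X × F => cub p.1) (fun p : X × F => cub p.1) (wOp X F w * covDb sh η Ui μ u * T) Y Y' ≤
      (1 + α) * blockNorm (fun p : X × F => cub p.1) (fun p : X × F => cub p.1)
          (wOp X F w * (Sbw X F sh μ * Dfw X F sh η μ) * T) Y Y' +
        Λ * α * blockNorm (fun p : X × F => cub p.1) (fun p : X × F => cub p.1) (wOp X F (fun x => w x ^ 2) * T) Y Y' := by
  -- `w∇⁻_U T = w∂⁻T − fibD c″·(w²T) + fibD (U⁻(· − e) − 1)·(w∂⁻T)`, `c″(x) = η⁻¹w(x)⁻¹(U⁻_μ(u,x − e_μ) − 1)`, rows `≤ Λα`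
  set c' : X → Matrix F F ℂ := fun x => (((η : ℂ)⁻¹) * ((((w x)⁻¹ : ℝ)) : ℂ)) • (Ui μ u ((sh μ).symm x) - 1) with hc'
  have hc'row : ∀ p : X × F, ∑ q, ‖fibD X F c' p q‖ ≤ Λ * α := fun p => by
    rw [rowSum_fibD]
    refine (rowSum_rescaled_le hη (hw p.1) p.2 (hUi ((sh μ).symm p.1) p.2)).trans ?_
    rw [mul_comm Λ α]
    refine mul_le_mul_of_nonneg_left ?_ hα
    rw [div_le_iff₀ (hw p.1)]
    exact hwb p.1
  have hc2row : ∀ p : X × F, ∑ q, ‖fibD X F (fun x => Ui μ u ((sh μ).symm x) - 1) p q‖ ≤ α := fun p => by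
    rw [rowSum_fibD]
    refine (hUi ((sh μ).symm p.1) p.2).trans ?_
    calc η * α * w ((sh μ).symm p.1) = α * (η * w ((sh μ).symm p.1)) := by ring
      _ ≤ α * 1 := mul_le_mul_of_nonneg_left (hηw _) hα
      _ = α := mul_one α
  have hloc : ∀ (c : X → Matrix F F ℂ) (p q : X × F),
      (fun p : X × F => cub p.1) p ≠ (fun p : X × F => cub p.1) q → fibD X F c p q = 0 :=
    fun c p q h => by_contra fun hne => h (fibD_local cub c p q hne)
  have e1 : ((η : ℂ)⁻¹) • fibD X F (fun x => Ui μ u ((sh μ).symm x) - 1) = fibD X F c' * wOp X F w := by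
    rw [fibD_mul_wOp, ← fibD_smul]
    congr 1; funext x
    rw [hc', smul_smul]
    congr 1
    have hx : ((w x : ℝ) : ℂ) ≠ 0 := by exact_mod_cast (hw x).ne'
    push_cast
    rw [mul_left_comm, mul_inv_cancel₀ hx, mul_one]
  have hη' : (η : ℂ) ≠ 0 := by exact_mod_cast hη.ne'
  have key : ((η : ℂ)⁻¹) • (fibD X F (fun x => Ui μ u ((sh μ).symm x) - 1) * Sbw X F sh μ) =
      fibD X F c' * wOp X F w - fibD X F (fun x => Ui μ u ((sh μ).symm x) - 1) * (Sbw X F sh μ * Dfw X F sh η μ) := by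
    conv_lhs => rw [Sbw_eq hη.ne' μ]
    rw [Matrix.mul_sub, Matrix.mul_one, smul_sub, e1, Matrix.mul_smul, smul_smul, inv_mul_cancel₀ hη', one_smul]
  have t1 : wOp X F w * (fibD X F c' * wOp X F w) * T = fibD X F c' * (wOp X F (fun x => w x ^ 2) * T) := by
    calc wOp X F w * (fibD X F c' * wOp X F w) * T = (wOp X F w * fibD X F c') * (wOp X F w * T) := by
          simp only [Matrix.mul_assoc]
      _ = fibD X F c' * (wOp X F (fun x => w x ^ 2) * T) := by
          rw [wOp_mul_fibD_comm, Matrix.mul_assoc, ← Matrix.mul_assoc (wOp X F w) (wOp X F w), wOp_mul_wOp]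
          simp only [pow_two]
  have t2 : wOp X F w * (fibD X F (fun x => Ui μ u ((sh μ).symm x) - 1) * (Sbw X F sh μ * Dfw X F sh η μ)) * T =
      fibD X F (fun x => Ui μ u ((sh μ).symm x) - 1) * (wOp X F w * (Sbw X F sh μ * Dfw X F sh η μ) * T) := by
    calc wOp X F w * (fibD X F (fun x => Ui μ u ((sh μ).symm x) - 1) * (Sbw X F sh μ * Dfw X F sh η μ)) * T =
          (wOp X F w * fibD X F (fun x => Ui μ u ((sh μ).symm x) - 1)) * (Sbw X F sh μ * Dfw X F sh η μ) * T := by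
            simp only [Matrix.mul_assoc]
      _ = fibD X F (fun x => Ui μ u ((sh μ).symm x) - 1) * (wOp X F w * (Sbw X F sh μ * Dfw X F sh η μ) * T) := by
          rw [wOp_mul_fibD_comm]; simp only [Matrix.mul_assoc]
  have hsplit : wOp X F w * covDb sh η Ui μ u * T =
      wOp X F w * (Sbw X F sh μ * Dfw X F sh η μ) * T + -(fibD X F c' * (wOp X F (fun x => w x ^ 2) * T)) +
        fibD X F (fun x => Ui μ u ((sh μ).symm x) - 1) * (wOp X F w * (Sbw X F sh μ * Dfw X F sh η μ) * T) := by
    rw [covDb_eq_flat, key, Matrix.mul_sub, Matrix.mul_sub, Matrix.sub_mul, Matrix.sub_mul, t1, t2]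
    abel
  rw [hsplit]
  have hB : blockNorm (fun p : X × F => cub p.1) (fun p : X × F => cub p.1) (-(fibD X F c' * (wOp X F (fun x => w x ^ 2) * T))) Y Y' ≤
      Λ * α * blockNorm (fun p : X × F => cub p.1) (fun p : X × F => cub p.1) (wOp X F (fun x => w x ^ 2) * T) Y Y' := by
    rw [blockNorm_neg]; exact blockNorm_local_mul_le _ _ (fibD X F c') (hloc c') (mul_nonneg hΛ hα) hc'row _ Y Y'
  refine ((blockNorm_add_le _ _ _ _ _ _).trans (add_le_add ((blockNorm_add_le _ _ _ _ _ _).trans (add_le_add le_rfl hB))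
    (blockNorm_local_mul_le _ _ (fibD X F _) (hloc _) hα hc2row _ Y Y'))).trans (le_of_eq ?_)
  ring

end Weighted

/-! ## §4. (v3) The flat case: at the trivial field `U ≡ 1` the covariant family IS the flat family `covDopW` -/

section FlatCase
variable {sh η} (w : X → ℝ)

omit [Fintype ι] in
/-- **`covDopU` at `U ≡ 1` is `covDopW`** (`∇_{1,μ} = ∂_μ`, `∇⁻_{1,μ} = S⁻_μ∂_μ`): the level-weighted flat family of the Cor. 3.5 ENDs is
the covariant family of the trivial field. -/
theorem covDopU_one (u : E) :
    covDopU sh η (fun (_ : ι) (_ : E) (_ : X) => (1 : Matrix F F ℂ)) (fun _ _ _ => 1) w u = covDopW X F sh η w := by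
  funext j
  rcases j with _ | (μ | μ)
  · rfl
  · simp only [covDopU, covDopW, covDf, Dfw, fibD_const_one, Matrix.one_mul]
  · simp only [covDopU, covDopW, covDb, Dfw, fibD_const_one, Matrix.one_mul, Matrix.mul_smul, Matrix.mul_sub, Matrix.mul_one,
      Sbw_mul_Sfw]

end FlatCase

end Summit.QuantumFields.BalabanUV.Gaps.D4WalkBlockCovariantDerivative

end
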